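import Summits.Parity.GeneralizedHardyLittlewood.Theorems.PrimeLevelFamEdgeMomentsBeyondDiagonalDiagDivisorPairs
import HarnessLib

/-!
# Route `PrimeLevelFamEdge`, crux K_A `MomentsBeyondDiagonal` (stmt-Parity-20007), line «petersson_layers» v4, stub `stub_diag`:
# **the weighted τ-decoupling: ordered factorisations of `uv` by Möbius inversion (census R3(ii), second brick)**

K_B's `CornerReduction.card_divisors_mul_eq_sum_moebius` decouples `τ(uv) = Σ_{g∣(u,v)} μ(g)τ(u/g)τ(v/g)`; the log-decorated
(general `Q`) diagonal needs the same for sums over the ORDERED FACTORISATIONS `n₁n₂ = uv` with arbitrary weights: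

* `sum_filter_dvd_pairs_eq` — `Σ_{d∣u/g}Σ_{e∣v/g} G(gd, ge) = Σ_{(d,e) ∈ div u × div v, g∣d, g∣e} G(d,e)`;
* `sum_coprime_pairs_eq_sum_moebius` — **`Σ_{(d,e) ∈ div u × div v, (d,e)=1} G(d,e) = Σ_{g∣(u,v)} μ(g)·Σ_{d∣u/g}Σ_{e∣v/g} G(gd, ge)`**;
* `sum_divisors_mul_eq_sum_moebius` — **`Σ_{D∣uv} F(D, uv/D) = Σ_{g∣(u,v)} μ(g)·Σ_{d∣u/g}Σ_{e∣v/g} F((u/(gd))·ge, gd·(v/(ge)))`**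
  (with `…DiagDivisorPairs.sum_divisors_mul_eq_sum_coprime_pairs`); for `F ≡ 1` this is `τ(uv) = Σ_g μ(g)τ(u/g)τ(v/g)`.
For a weight `F(n₁,n₂) = n₁^{s₁}n₂^{s₂}` (or its `s`-derivatives = log-decorations) the inner double sum FACTORS into a
`u`-part times a `v`-part — the decorated Selberg decoupling.

Def-free; theorems only. Helper `--supports stmt-Parity-20007`; closes nothing; K_A, K_B and the Parity summit are NOT
proved; nothing about Landau–Siegel zeros.

## References
* E. Kowalski, P. Michel, J. VanderKam, J. reine angew. Math. 526 (2000), (10) p. 7, (21)–(23) pp. 12–13.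
  [cite: KowalskiMichelVanderKam2000, (10) p. 7 — derivation (weighted Möbius form)]
-/

open Finset
open scoped ArithmeticFunction.Moebius ArithmeticFunction.zeta

namespace Summit.Parity.GeneralizedHardyLittlewood.Theorems.MomentsBeyondDiagonal.DiagLines

open ArithmeticFunction

/-- **Scaling the pairs**: for `g ∣ u`, `g ∣ v` (`u, v ≥ 1`) and any weight `G`,
`Σ_{d∣u/g} Σ_{e∣v/g} G(gd, ge) = Σ_{(d,e) ∈ div u × div v, g∣d ∧ g∣e} G(d,e)`. [folklore] -/
theorem sum_filter_dvd_pairs_eq {M : Type*} [AddCommMonoid M] {u v g : ℕ} (hu : u ≠ 0) (hv : v ≠ 0)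
    (hgu : g ∣ u) (hgv : g ∣ v) (G : ℕ → ℕ → M) :
    ∑ d ∈ (u / g).divisors, ∑ e ∈ (v / g).divisors, G (g * d) (g * e) =
      ∑ p ∈ (u.divisors ×ˢ v.divisors).filter (fun p => g ∣ p.1 ∧ g ∣ p.2), G p.1 p.2 := by
  have hg0 : g ≠ 0 := by rintro rfl; exact hu (zero_dvd_iff.mp hgu)
  have hgpos : 0 < g := Nat.pos_of_ne_zero hg0
  obtain ⟨u', rfl⟩ := hgu
  obtain ⟨v', rfl⟩ := hgv
  have hu' : u' ≠ 0 := by rintro rfl; exact hu (mul_zero g)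
  have hv' : v' ≠ 0 := by rintro rfl; exact hv (mul_zero g)
  rw [Nat.mul_div_cancel_left u' hgpos, Nat.mul_div_cancel_left v' hgpos,
    ← Finset.sum_product (s := u'.divisors) (t := v'.divisors) (f := fun p : ℕ × ℕ => G (g * p.1) (g * p.2))]
  refine Finset.sum_bij' (fun p _ => (g * p.1, g * p.2)) (fun p _ => (p.1 / g, p.2 / g)) ?_ ?_ ?_ ?_ ?_
  · rintro ⟨d, e⟩ hp
    simp only [mem_product, Nat.mem_divisors] at hp
    simp only [mem_filter, mem_product, Nat.mem_divisors]
    obtain ⟨⟨hd, -⟩, ⟨he, -⟩⟩ := hp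
    exact ⟨⟨⟨mul_dvd_mul_left g hd, hu⟩, ⟨mul_dvd_mul_left g he, hv⟩⟩, dvd_mul_right g d, dvd_mul_right g e⟩
  · rintro ⟨d, e⟩ hp
    simp only [mem_filter, mem_product, Nat.mem_divisors] at hp
    simp only [mem_product, Nat.mem_divisors]
    obtain ⟨⟨⟨hd, -⟩, ⟨he, -⟩⟩, hgd, hge⟩ := hp
    obtain ⟨d', rfl⟩ := hgd
    obtain ⟨e', rfl⟩ := hge
    rw [Nat.mul_div_cancel_left d' hgpos, Nat.mul_div_cancel_left e' hgpos]
    exact ⟨⟨Nat.dvd_of_mul_dvd_mul_left hgpos hd, hu'⟩, ⟨Nat.dvd_of_mul_dvd_mul_left hgpos he, hv'⟩⟩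
  · rintro ⟨d, e⟩ _
    show (g * d / g, g * e / g) = (d, e)
    rw [Nat.mul_div_cancel_left d hgpos, Nat.mul_div_cancel_left e hgpos]
  · rintro ⟨d, e⟩ hp
    simp only [mem_filter, mem_product, Nat.mem_divisors] at hp
    obtain ⟨-, hgd, hge⟩ := hp
    show (g * (d / g), g * (e / g)) = (d, e)
    rw [Nat.mul_div_cancel' hgd, Nat.mul_div_cancel' hge]
  · rintro ⟨d, e⟩ _
    rfl

/-- **Coprime divisor pairs by Möbius inversion**: for `u, v ≥ 1` and any weight `G` with values in an additive
commutative group, `Σ_{(d,e) ∈ div u × div v, (d,e)=1} G(d,e) = Σ_{g ∣ gcd(u,v)} μ(g)·Σ_{d∣u/g}Σ_{e∣v/g} G(gd, ge)`.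
[cite: KowalskiMichelVanderKam2000, (10) p. 7 — derivation (weighted Möbius form)] -/
theorem sum_coprime_pairs_eq_sum_moebius {M : Type*} [AddCommGroup M] {u v : ℕ} (hu : u ≠ 0) (hv : v ≠ 0)
    (G : ℕ → ℕ → M) :
    ∑ p ∈ (u.divisors ×ˢ v.divisors).filter (fun p => Nat.Coprime p.1 p.2), G p.1 p.2 =
      ∑ g ∈ (Nat.gcd u v).divisors, (μ g : ℤ) • ∑ d ∈ (u / g).divisors, ∑ e ∈ (v / g).divisors, G (g * d) (g * e) := by
  set P := u.divisors ×ˢ v.divisors with hP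
  -- rewrite each inner double sum as a filtered sum over `P` and expand the filter as an `ite`
  have h1 : ∀ g ∈ (Nat.gcd u v).divisors,
      (μ g : ℤ) • ∑ d ∈ (u / g).divisors, ∑ e ∈ (v / g).divisors, G (g * d) (g * e) =
        ∑ p ∈ P, if g ∣ p.1 ∧ g ∣ p.2 then (μ g : ℤ) • G p.1 p.2 else 0 := by
    intro g hg
    obtain ⟨hguv, -⟩ := Nat.mem_divisors.mp hg
    rw [sum_filter_dvd_pairs_eq hu hv (hguv.trans (Nat.gcd_dvd_left u v)) (hguv.trans (Nat.gcd_dvd_right u v)) G,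
      Finset.sum_filter, Finset.smul_sum]
    refine Finset.sum_congr rfl fun p _ => ?_
    split_ifs <;> simp
  rw [Finset.sum_congr rfl h1, Finset.sum_comm]
  -- for each pair, the `g`-sum is the Möbius sum over the divisors of `gcd(d,e)`
  rw [Finset.sum_filter]
  refine Finset.sum_congr rfl fun p hp => ?_
  rcases p with ⟨d, e⟩
  simp only [hP, mem_product, Nat.mem_divisors] at hp
  obtain ⟨⟨hd, -⟩, ⟨he, -⟩⟩ := hp
  have hd0 : d ≠ 0 := by rintro rfl; exact hu (zero_dvd_iff.mp hd)
  have hset : ((Nat.gcd u v).divisors).filter (fun g => g ∣ d ∧ g ∣ e) = (Nat.gcd d e).divisors := by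
    ext g
    simp only [mem_filter, Nat.mem_divisors, Nat.dvd_gcd_iff]
    constructor
    · rintro ⟨-, hgd, hge⟩
      exact ⟨⟨hgd, hge⟩, Nat.gcd_ne_zero_left hd0⟩
    · rintro ⟨⟨hgd, hge⟩, -⟩
      exact ⟨⟨⟨hgd.trans hd, hge.trans he⟩, Nat.gcd_ne_zero_left hu⟩, hgd, hge⟩
  -- `Σ_{g ∣ n} μ(g) = [n = 1]` (as `Literature…CubicSieve.sum_divisors_moebius_eq`, inlined to keep the imports light)
  have hmoeb : ∑ g ∈ (Nat.gcd d e).divisors, (μ g : ℤ) = if Nat.gcd d e = 1 then 1 else 0 := by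
    have h := congrArg (fun f : ArithmeticFunction ℤ ↦ f (Nat.gcd d e)) moebius_mul_coe_zeta
    simpa only [coe_mul_zeta_apply, one_apply] using h
  rw [← Finset.sum_filter, hset, ← Finset.sum_smul, hmoeb]
  by_cases hc : Nat.Coprime d e
  · rw [if_pos hc, if_pos (Nat.Coprime.gcd_eq_one hc), one_smul]
  · rw [if_neg hc, if_neg (fun h => hc h), zero_smul]

/-- **The weighted τ-decoupling**: for `u, v ≥ 1` and any weight `F` on ordered factorisations,
`Σ_{D ∣ uv} F(D, uv/D) = Σ_{g ∣ gcd(u,v)} μ(g)·Σ_{d∣u/g}Σ_{e∣v/g} F((u/(gd))·(ge), (gd)·(v/(ge)))`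
(`F ≡ 1`: `τ(uv) = Σ_g μ(g)τ(u/g)τ(v/g)`, `CornerReduction.card_divisors_mul_eq_sum_moebius`).
[cite: KowalskiMichelVanderKam2000, (10) p. 7 and (21)–(23) — derivation (weighted Möbius decoupling of the diagonal)] -/
theorem sum_divisors_mul_eq_sum_moebius {M : Type*} [AddCommGroup M] {u v : ℕ} (hu : u ≠ 0) (hv : v ≠ 0)
    (F : ℕ → ℕ → M) :
    ∑ D ∈ (u * v).divisors, F D (u * v / D) =
      ∑ g ∈ (Nat.gcd u v).divisors, (μ g : ℤ) •
        ∑ d ∈ (u / g).divisors, ∑ e ∈ (v / g).divisors, F (u / (g * d) * (g * e)) (g * d * (v / (g * e))) := by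
  rw [sum_divisors_mul_eq_sum_coprime_pairs hu hv F]
  exact sum_coprime_pairs_eq_sum_moebius hu hv (fun d e => F (u / d * e) (d * (v / e)))

end Summit.Parity.GeneralizedHardyLittlewood.Theorems.MomentsBeyondDiagonal.DiagLines
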